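import Summits.CriticalPhenomena.PercolationContinuityZ3.Theses.PercLowPointHalfSpace
import Literature.Probability.Percolation.HalfSpaceProofs
import HarnessLib

/-!
# Crux-strategist s2 (session B) — typed census statements for `QuantitativeBGN` (stmt-CriticalPhenomena-0913)

NOT a line skeleton (no `QuantitativeBGN_of`). These are the statements attempted in
`CENSUS-ANNEX-s2B.md` / `STRATEGY-CENSUS.md` (§Transfer, §Strengthen, §Decomposition), typed over
tree vocabulary so that the census "gives signatures, not adjectives". Every `theorem` body is
`sorry`; the docstring says which are PROVABLE NOW (identities valid at every `p`, or soft
consequences of BGN) and which are OPEN, and — the point of the census — why none of them gives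
leverage on the crux.

Vocabulary: `halfSpaceCluster ω = U = C_H(0)`, `halfSpaceFootprint ω = F = |U ∩ ∂H|`
(`Literature/Probability/Percolation/HalfSpacePinnedPairs.lean`), `μ = P_{p_c(ℤ³)}`.
-/

noncomputable section

namespace Summit.CriticalPhenomena.PercolationContinuityZ3.Cruxes.QuantitativeBGN.StrategistS2B

open MeasureTheory Filter Literature.Probability.Percolation Literature.Probability.LatticeModels
open scoped ENNReal Topology

/-- The critical bond measure on `ℤ³`. -/
abbrev μ : Measure (BondConfig (Site 3)) := bondPercolation (zdGraph 3) (criticalProbI 3)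

/-- The point `k·e₀ = (k,0,0)` at height `k` above the wall. -/
abbrev axisPt (k : ℕ) : Site 3 := Pi.single 0 (k : ℤ)

/-! ## §Transfer-6 (Galton–Watson / level transport): the WALL-RETURN function `ρ` -/

/-- `ρ(k) = P_{p_c}(k·e₀ ↔ ∂H in H)`: the half-space cluster of the point at height `k` reaches the
wall. -/
def wallReturn (k : ℕ) : ℝ :=
  μ.real {ω | ∃ y : Site 3, y 0 = 0 ∧ ω ∈ openConnIn (halfSpace 3) (axisPt k) y}

/-- Level-`k` population of `U`: `N_k(U) = |U ∩ {x₀ = k}|`. -/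
def levelCount (ω : BondConfig (Site 3)) (k : ℕ) : ℕ∞ :=
  (halfSpaceCluster ω ∩ {x | x 0 = (k : ℤ)}).encard

/-- **Level transport (PROVABLE NOW, every `p`)**: `E[N_k(U)/F(U)] = ρ(k)` — horizontal mass
transport on the floor `ℤ²` (send mass `1/F(C_H(u))` from each floor point `u` of a half-space
cluster to each of its level-`k` points; the mass arriving at `k·e₀` is `1{C_H(k·e₀) ∋ a floor point}`).
This is the `m = ∞` case of lead c5's `E[N_h·1{F ≤ m}/F] ≤ 1` (p137452). -/
theorem lintegral_levelCount_div_footprint (k : ℕ) :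
    ∫⁻ ω, ((levelCount ω k : ℕ∞) : ℝ≥0∞) / ((halfSpaceFootprint ω : ℕ∞) : ℝ≥0∞) ∂μ =
      ENNReal.ofReal (wallReturn k) := by
  sorry

/-- **`ρ(k) ≥ θ(p_c)` (PROVABLE NOW)**: on `{k·e₀ ↔ ∞}` the a.s.-finite (BGN, translated + finite
energy) half-space cluster `C_H(k·e₀)` must contain the last vertex of `H` on an infinite open path,
which is a floor vertex. Hence `ρ(k) → 0` would give `θ(p_c) = 0`. -/
theorem theta_le_wallReturn (k : ℕ) :
    theta (zdGraph 3) (0 : Site 3) (criticalProbI 3) ≤ wallReturn k := by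
  sorry

/-- **The level-transport route to the thin child is SUMMIT-EQUIVALENT (PROVABLE NOW)**:
`ρ(k) ≤ π(k) ↓ θ(p_c)` (the event forces an arm of length `k` from `k·e₀`) and `ρ(k) ≥ θ(p_c)`, so
`ρ(k) → θ(p_c)`; in particular `(ρ → 0) ↔ θ(p_c) = 0`. -/
theorem percolationContinuityZ3_iff_tendsto_wallReturn :
    _root_.PercolationContinuityZ3 ↔ Tendsto wallReturn atTop (𝓝 0) := by
  sorry

/-- **Thin child from a wall-return RATE (PROVABLE NOW, Markov + level transport)**:
`P(U reaches height k, F ≤ m) ≤ E[N_k; F ≤ m] ≤ m·E[N_k/F] = m·ρ(k)`, so `ρ(k) ≤ C k^{-a}` gives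
`ThinFootHigh` with `δ = a/2`. By the previous theorem the hypothesis implies the SUMMIT, so this
is recorded as an obstruction (census §Transfer-6), not as a line. -/
theorem thinFootHigh_of_wallReturn_rate
    (h : ∃ a C : ℝ, 0 < a ∧ ∀ k : ℕ, 1 ≤ k → wallReturn k ≤ C * (k : ℝ) ^ (-a)) :
    ∃ a δ C : ℝ, 0 < a ∧ 0 < δ ∧ ∀ k : ℕ, 1 ≤ k →
      μ.real ({ω | ∃ v ∈ halfSpaceCluster ω, (k : ℤ) ≤ v 0} ∩
        {ω | halfSpaceFootprint ω ≤ ((⌊(k : ℝ) ^ δ⌋₊ : ℕ) : ℕ∞)}) ≤ C * (k : ℝ) ^ (-a) := by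
  sorry

/-! ## §Strengthen-5: the HEIGHT SUM RULE and the height-density monotonicity S⁺ -/

/-- `{M(U) = j}`: the maximal height of the half-space cluster is exactly `j`. -/
def heightIs (j : ℕ) : Set (BondConfig (Site 3)) :=
  {ω | (∃ v ∈ halfSpaceCluster ω, v 0 = (j : ℤ)) ∧ ∀ w ∈ halfSpaceCluster ω, w 0 ≤ (j : ℤ)}

/-- **Height sum rule (PROVABLE NOW from BGN)**: `Σ_j P_{p_c}(M = j) = 1` — `U` is a.s. finite and
nonempty, so it has a maximal height. This (and not more) is what BGN says about the law of `M`;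
it holds verbatim in a `θ(p_c) > 0` world (BGN holds there too), so it cannot by itself give a rate. -/
theorem hasSum_heightIs : HasSum (fun j : ℕ => μ.real (heightIs j)) 1 := by
  sorry

/-- The cluster of `0` in the slab `S_k = {0 ≤ x₀ ≤ k}` (the half-space cluster truncated at height `k`). -/
def slabCluster (k : ℕ) (ω : BondConfig (Site 3)) : Set (Site 3) :=
  {v | ω ∈ openConnIn {x : Site 3 | 0 ≤ x 0 ∧ x 0 ≤ (k : ℤ)} 0 v}

/-- Top print `N_k(U^{(k)}) = |U^{(k)} ∩ {x₀ = k}|` of the slab cluster. -/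
def slabTop (k : ℕ) (ω : BondConfig (Site 3)) : ℕ∞ := (slabCluster k ω ∩ {x | x 0 = (k : ℤ)}).encard

/-- Footprint `F(U^{(k)}) = |U^{(k)} ∩ {x₀ = 0}|` of the slab cluster. -/
def slabFoot (k : ℕ) (ω : BondConfig (Site 3)) : ℕ∞ := (slabCluster k ω ∩ {x | x 0 = 0}).encard

/-- **Thin-top sealing (PROVABLE NOW, every `p`)**: `P(M = k) = E[(1-p)^{N_k(U^{(k)})}; N_k ≥ 1]`
(the up-edges from the top print are independent of the slab configuration), hence
`P(M = k) ≥ (1 - p_c)^m · P(1 ≤ N_k(U^{(k)}) ≤ m)`. -/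
theorem heightIs_ge_thinTop (k m : ℕ) :
    (1 - (criticalProbI 3 : ℝ)) ^ m * μ.real ({ω | 1 ≤ slabTop k ω} ∩ {ω | slabTop k ω ≤ (m : ℕ∞)}) ≤
      μ.real (heightIs k) := by
  sorry

/-- **Slab reflection identity, thin FOOT ↔ thin TOP (PROVABLE NOW, every `p`)**: by the symmetry
`x₀ ↦ k - x₀` of `S_k` composed with horizontal re-rooting, `E[ψ(U^{(k)})·N_k/F] = E[ψ∘σ(U^{(k)}); N_k ≥ 1]`
(`σ` swaps foot and top); with `ψ = 1{F ≤ m}` and `N_k/F ≥ 1/m` on the event: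
`P(N_k(U^{(k)}) ≥ 1, F(U^{(k)}) ≤ m) ≤ m · P(1 ≤ N_k(U^{(k)}) ≤ m)`. Since `{U reaches height k} =
{N_k(U^{(k)}) ≥ 1}` and `F(U^{(k)}) ≤ F(U)`, the thin-FOOT tall event of the crux's thin child is
bounded by `m` times the thin-TOP tall event, and by `heightIs_ge_thinTop` by
`m (1-p_c)^{-m} P(M = k)`: informative only for `m = O(log k)` (census §Strengthen-5 / §Decomposition). -/
theorem real_thinFoot_le_mul_thinTop (k m : ℕ) (hm : 1 ≤ m) :
    μ.real ({ω | 1 ≤ slabTop k ω} ∩ {ω | slabFoot k ω ≤ (m : ℕ∞)}) ≤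
      m * μ.real ({ω | 1 ≤ slabTop k ω} ∩ {ω | slabTop k ω ≤ (m : ℕ∞)}) := by
  sorry

/-- **S⁺₅ `HeightDensityMono` (OPEN; no tool)**: the density of the height law is non-increasing.
Numerically `P(M = k) ≈ k^{-1-x_s}`; a proof would be a monotonicity-in-distance statement of the
kind that is open even for `τ(0, n e₁)` on `ℤ^d`. -/
def HeightDensityMono : Prop := ∀ j : ℕ, μ.real (heightIs (j + 1)) ≤ μ.real (heightIs j)

/-- **What S⁺₅ would buy (PROVABLE NOW from the sum rule)**: `P(M = k) ≤ 1/(k+1)` — a genuine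
local rate at `p_c`, but NOT the crux: a monotone summable sequence has `k·a_k → 0` yet its tails
`Σ_{j ≥ k} a_j` carry no rate (e.g. `a_j = 1/(j log² j)`), and `QuantitativeBGN` is the tail
statement `P(M ≥ k) ≤ C k^{-a}` (height form, c5 `ThinFootReshape`). -/
theorem heightIs_le_inv_of_mono (h : HeightDensityMono) (k : ℕ) :
    μ.real (heightIs k) ≤ 1 / ((k : ℝ) + 1) := by
  sorry

/-! ## §Transfer-1′ (2D RSW, dual form): blocking events GLUE in `d = 3` -/

/-- Open crossing of the region `S` between the coordinate hyperplanes `{x_i = a}` and `{x_i = b}`. -/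
def crossIn (S : Set (Site 3)) (i : Fin 3) (a b : ℤ) : Set (BondConfig (Site 3)) :=
  {ω | ∃ u v : Site 3, u i = a ∧ v i = b ∧ ω ∈ openConnIn S u v}

/-- The box `[a₀,b₀] × [0,n] × [0,n]`. -/
def xBox (a₀ b₀ n : ℤ) : Set (Site 3) := {x | a₀ ≤ x 0 ∧ x 0 ≤ b₀ ∧ 0 ≤ x 1 ∧ x 1 ≤ n ∧ 0 ≤ x 2 ∧ x 2 ≤ n}

/-- **Deterministic gluing for BLOCKING events (PROVABLE NOW, ~60 lines; census §Transfer-1′)**: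
an open bottom-top (`x₂`-direction) crossing of the long box `[0,3n]×[0,n]²` either stays inside
`B₁ = [0,2n]×[0,n]²`, or inside `B₂ = [n,3n]×[0,n]²`, or contains a segment crossing the overlap
cube `O = [n,2n]×[0,n]²` in the `x₀`-direction (last visit to `{x₀ = n}` before the first visit to
`{x₀ = 2n}`, or symmetrically). Contrapositive: closed separating sheets of `B₁`, `B₂` and an
`x₀`-blocking of `O` give a separating sheet of `B₁ ∪ B₂` — the RSW gluing step, which FAILS for
open paths in `d = 3` (`TransverseCrossingsNeedNotMeet`), is FREE for the dual (blocking) events;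
with FKG (all three are decreasing) `P(Block(B₁ ∪ B₂)) ≥ P(Block B₁)·P(Block B₂)·P(Block_x O)`.
What remains of RSW is the one-scale input `P_{p_c}(Block cube) ≥ c` and the square→rectangle
step — both BULK statements of `CritAnnulusNonCrossing` (stmt-0846) strength, hence summit-side
(census: dominance O1). -/
theorem crossIn_long_subset (n : ℕ) :
    crossIn (xBox 0 (3 * n) n) 2 0 n ⊆
      crossIn (xBox 0 (2 * n) n) 2 0 n ∪ crossIn (xBox n (3 * n) n) 2 0 n ∪
        crossIn (xBox n (2 * n) n) 0 n (2 * n) := by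
  sorry

end Summit.CriticalPhenomena.PercolationContinuityZ3.Cruxes.QuantitativeBGN.StrategistS2B

end
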